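import Literature.AlgebraicGeometry.Frobenioids.QuasiTemperoidGaloisPadicFields
import Literature.AlgebraicGeometry.Frobenioids.QuasiTemperoidGaloisFieldsEquivalence
import Literature.AlgebraicGeometry.Frobenioids.QuasiTemperoidConnectedPart
import Mathlib.Topology.Algebra.Group.ClosedSubgroup
import HarnessLib

/-!
# Frobenioids II, Example 1.3 / §2 p. 20: Galois objects and Galois closures in `B^temp(Π)⁰`

Mochizuki, *The geometry of Frobenioids II: poly-Frobenioids*, Kyushu J. Math. **62** (2008)
401–460, §1 Example 1.3 (the base categories `B^temp(Π, Π°)⁰ → B^temp(G_{ℚ_p})⁰`) and §2, proof of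
Theorem 2.4 (i), kurims text `paper:url-4322d76898e0` p. 20 ll. 12–26, quoted verbatim
[cite: MochizukiFrdII2008, Thm 2.4 (i) p.20]: "We begin by observing the [easily verified] fact that `Φ_i`
is fieldwise saturated if and only if the following two conditions hold: (a) The inductive limit monoid
`lim_{→} Φ_i(B)` [where `B` ranges over the objects of `D_i`] is divisible. (b) For every pull-back morphism
`φ : B → C` of `C_i` that projects to a Galois covering `φ_D : B_D → C_D` of `D_i`, the injection
`O^⊳(C) ↪ O^⊳(B)` induced by `φ` [cf. [Mzk5], Proposition 1.11, (iv)] determines a bijection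
`O^⊳(C) ⥲ O^⊳(B)^{Gal(B/C)}` [where the superscript “`Gal(B/C)`” denotes the submonoid of
`Gal(B/C)`-invariants; `Gal(B/C) := Gal(B_D/C_D)`]."  (End of quotation; what follows is OUR reading, not
print's words.)  Condition (b) is usable because the base is the Galois-correspondence category: every
morphism of the base is DOMINATED BY A GALOIS ONE (Galois closure), and over a Galois morphism the fixed
field of the deck transformations is the smaller field.  abc-iut-w5-d229's criterion
(`PadicFieldwiseSaturatedCriterion.lean`, sub-DAG W12 of plan/L1/DISCHARGE-L1.md §0, row L01) carries
these as the base-richness binders `H_dom`, `H_fix`; this PROOF-ONLY file (no definition, no named fact;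
seat abc-iut-w5-d174, row W12-L01b-α `BaseRichness`, by-name assignment R97 (5)) supplies the
GROUP-THEORETIC half — Galois objects and Galois closures in `B^temp(Π)⁰` for an arbitrary tempered
(resp. compact tempered) `Π`:

* `exists_iso_comp_eq_of_comp_eq` — **a connected object `X` whose base point has a NORMAL
  stabiliser is intrinsically Galois over every `Y`**: two arrows `k, k' : B′ ⟶ X` out of a connected
  `B′` that are co-equal over `f : X ⟶ Y` differ by an automorphism of `X` over `Y` (the right
  translation of `Π/N` by `x⁻¹x'`);
* `exists_normal_galois_dominating` — **Galois closure**: for `Π` compact (open stabilisers have finite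
  index) every connected `B₁` is dominated, `X ⟶ B₁`, by a connected `X = Π/N` with `N ⊴ Π` open normal
  (the normal core of the stabiliser of a point of `B₁`), hence intrinsically Galois over every `C`
  under `B₁`.
and then DISCHARGES BOTH BINDERS for the Galois-correspondence base `B^temp(G_F)⁰ → D₀`
(`QuasiTemperoid.galoisFields F`, `F` perfect; valued form `QuasiTemperoid.galoisPadicFields p`) with the
class of Galois coverings `Gal f := (Stab(x_B) ⊴ G_F normal)` for `f : B → C`:

* `galoisFields_hdom` / `galoisPadicFields_hdom` — `H_dom` in EXACTLY the binder shape
  `∀ ⦃B₁ C⦄ (f₁ : B₁ ⟶ C), ∃ B (g : B ⟶ B₁), Gal (g ≫ f₁)`;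
* `exists_fieldMap_eq_of_forall_over` — **`H_fix` (Galois theory)**: for `f : B → C` with `B` Galois,
  an element of `K_B = F̄^{Stab(x_B)}` fixed by the field maps of all `σ : B → B` over `C` comes from
  `K_C = F̄^{Stab(x_C)}` along `f` (the `σ` over `C` realise every `h ∈ Stab(f(x_B)) = g_f Stab(x_C) g_f⁻¹`,
  so the element lies in `F̄^{Stab(f x_B)} = g_f · K_C`); `galoisFields_hfix` / `galoisPadicFields_hfix` —
  the same in EXACTLY the binder shape `∀ ⦃B C⦄ (f : B ⟶ C), Gal f → ∀ x : K_B, (∀ σ, σ ≫ f = f →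
  (base.map σ).alg x = x) → ∃ x₀ : K_C, (base.map f).alg x₀ = x`.
Classical (Galois categories, Galois theory); nothing here bears on [IUTchIII] Cor. 3.12.
-/

noncomputable section

namespace Literature.AlgebraicGeometry.Frobenioids

namespace QuasiTemperoid

open CategoryTheory Topology
open Literature.AnabelianGeometry.SemiGraphs
open BTempConnected

universe u

variable {G : Type u} [Group G] [TopologicalSpace G]

/-! ### Galois objects: a normal point-stabiliser makes all stabilisers equal -/

/-- If the stabiliser of one point of a connected object is normal, it is the stabiliser of EVERY point
(stabilisers along an orbit are conjugate). [cite: MochizukiFrdII2008, Ex 1.3 (i) p.11] -/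
theorem stabilizerSubgroup_eq_of_normal (X : ConnectedPart (BTemp G)) (x₀ : X.obj.obj.V)
    [hN : (stabilizerSubgroup X.obj x₀).Normal] (x : X.obj.obj.V) :
    stabilizerSubgroup X.obj x = stabilizerSubgroup X.obj x₀ := by
  obtain ⟨g, rfl⟩ := exists_ρ_eq_of_isConnectedObj X.obj X.property x₀ x
  ext h
  rw [mem_stabilizerSubgroup_iff, mem_stabilizerSubgroup_iff]
  constructor
  · intro hh
    -- `g⁻¹ h g` fixes `x₀`, hence (normality) so does `h = g (g⁻¹ h g) g⁻¹`
    have h1 : X.obj.obj.ρ (g⁻¹ * h * g) x₀ = x₀ := by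
      rw [ρ_mul_apply, ρ_mul_apply, hh, ρ_inv_apply]
    have h2 := hN.conj_mem _ h1 g
    rwa [show g * (g⁻¹ * h * g) * g⁻¹ = h by group] at h2
  · intro hh
    have h2 : g⁻¹ * h * g ∈ stabilizerSubgroup X.obj x₀ := by
      have := hN.conj_mem _ hh g⁻¹
      rwa [inv_inv] at this
    rw [mem_stabilizerSubgroup_iff, ρ_mul_apply, ρ_mul_apply] at h2
    have h3 := congrArg (X.obj.obj.ρ g) h2
    rwa [ρ_apply_inv] at h3

/-- **Right translations**: for a connected `X` whose base-point stabiliser `N` is normal and any two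
points `x, x'`, there is an automorphism `τ` of `X` with `τ x = x'` (for `X = Π/N`: `gN ↦ g x⁻¹ x' N`).
[cite: MochizukiFrdII2008, Ex 1.3 (i) p.11] -/
theorem exists_iso_apply_eq (X : ConnectedPart (BTemp G)) (x₀ : X.obj.obj.V)
    [hN : (stabilizerSubgroup X.obj x₀).Normal] (x x' : X.obj.obj.V) :
    ∃ τ : X ≅ X, ptMap τ.hom x = x' := by
  -- the equivariant map `x ↦ x'` exists since `Stab(x) = N = Stab(x')`
  have htr : ∀ r : X.obj.obj.V, ∃ g : G, X.obj.obj.ρ g x = r :=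
    exists_ρ_eq_of_isConnectedObj X.obj X.property x
  have hle : ∀ g : G, X.obj.obj.ρ g x = x → X.obj.obj.ρ g x' = x' := fun g hg => by
    have h1 : g ∈ stabilizerSubgroup X.obj x := (mem_stabilizerSubgroup_iff).mpr hg
    rw [stabilizerSubgroup_eq_of_normal X x₀ x, ← stabilizerSubgroup_eq_of_normal X x₀ x'] at h1
    exact (mem_stabilizerSubgroup_iff).mp h1
  obtain ⟨t, ht⟩ := exists_hom_of_stabilizer_le (T₁ := X.obj) (T₂ := X.obj) x htr x' hle
  -- it is bijective (its "inverse" `x' ↦ x` is a two-sided inverse by the one-point criterion)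
  have hle' : ∀ g : G, X.obj.obj.ρ g x' = x' → X.obj.obj.ρ g x = x := fun g hg => by
    have h1 : g ∈ stabilizerSubgroup X.obj x' := (mem_stabilizerSubgroup_iff).mpr hg
    rw [stabilizerSubgroup_eq_of_normal X x₀ x', ← stabilizerSubgroup_eq_of_normal X x₀ x] at h1
    exact (mem_stabilizerSubgroup_iff).mp h1
  obtain ⟨s, hs⟩ := exists_hom_of_stabilizer_le (T₁ := X.obj) (T₂ := X.obj) x'
    (exists_ρ_eq_of_isConnectedObj X.obj X.property x') x hle'
  have hts : t ≫ s = 𝟙 X.obj :=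
    hom_eq_of_apply_eq X.property _ _ x (by
      change (s.hom.hom (t.hom.hom x) : X.obj.obj.V) = x
      rw [ht, hs])
  have hst : s ≫ t = 𝟙 X.obj :=
    hom_eq_of_apply_eq X.property _ _ x' (by
      change (t.hom.hom (s.hom.hom x') : X.obj.obj.V) = x'
      rw [hs, ht])
  exact ⟨(connectedObjects (BTemp G)).isoMk ⟨t, s, hts, hst⟩, ht⟩

/-- **A connected object with normal point-stabiliser is intrinsically Galois over every object under
it**: if `k, k' : B′ ⟶ X` (with `B′` connected) satisfy `k ≫ f = k' ≫ f` for some `f : X ⟶ Y`, then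
`k ≫ τ = k'` for an automorphism `τ` of `X` OVER `Y` (`τ ≫ f = f`).  For `X = Π/N` and `k(b) = xN`,
`k'(b) = x'N`: `τ` is the right translation by `x⁻¹x'`, which lies over `Y` because `x⁻¹x'` stabilises
`f(N)`. [cite: MochizukiFrdII2008, Thm 2.4 (i) p.20] -/
theorem exists_iso_comp_eq_of_comp_eq (X : ConnectedPart (BTemp G)) (x₀ : X.obj.obj.V)
    [hN : (stabilizerSubgroup X.obj x₀).Normal] {B' Y : ConnectedPart (BTemp G)}
    (k k' : B' ⟶ X) (f : X ⟶ Y) (h : k ≫ f = k' ≫ f) :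
    ∃ τ : X ≅ X, k ≫ τ.hom = k' ∧ τ.hom ≫ f = f := by
  obtain ⟨b⟩ := nonempty_of_isConnectedObj B'.obj B'.property
  obtain ⟨τ, hτ⟩ := exists_iso_apply_eq X x₀ (ptMap k b) (ptMap k' b)
  refine ⟨τ, ?_, ?_⟩
  · apply ObjectProperty.hom_ext
    exact hom_eq_of_apply_eq B'.property _ _ b (by
      change (τ.hom.hom.hom (k.hom.hom b) : X.obj.obj.V) = k'.hom.hom b
      exact hτ)
  · apply ObjectProperty.hom_ext
    exact hom_eq_of_apply_eq X.property _ _ (ptMap k b) (by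
      change (f.hom.hom (τ.hom.hom.hom (k.hom.hom b)) : Y.obj.obj.V) = f.hom.hom (k.hom.hom b)
      have hk : (f.hom.hom (k.hom.hom b) : Y.obj.obj.V) = f.hom.hom (k'.hom.hom b) := by
        change ((k ≫ f).hom.hom b : Y.obj.obj.V) = (k' ≫ f).hom.hom b
        rw [h]
      rw [hk]
      exact congrArg (fun z => (f.hom.hom z : Y.obj.obj.V)) hτ)

/-! ### Galois closure: domination by a coset object `Π/N`, `N` open normal -/

section Compact

variable [IsTopologicalGroup G] [CompactSpace G]

/-- **The normal core of an open subgroup of a compact group is open** (it has finite index and is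
closed). [folklore] -/
private theorem isOpen_normalCore_of_isOpen (S : Subgroup G) (hS : IsOpen (S : Set G)) :
    IsOpen (S.normalCore : Set G) := by
  haveI : Finite (G ⧸ S) := Subgroup.quotient_finite_of_isOpen S hS
  haveI : S.FiniteIndex := Subgroup.finiteIndex_of_finite_quotient
  have hclosed : IsClosed (S.normalCore : Set G) := by
    have hset : (S.normalCore : Set G) = ⋂ b : G, (fun a : G => b * a * b⁻¹) ⁻¹' (S : Set G) := by
      ext a
      simp only [SetLike.mem_coe, Set.mem_iInter, Set.mem_preimage]
      exact Iff.rfl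
    rw [hset]
    exact isClosed_iInter fun b => (Subgroup.isClosed_of_isOpen S hS).preimage (by fun_prop)
  exact Subgroup.isOpen_of_isClosed_of_finiteIndex _ hclosed

/-- **Galois closure in `B^temp(Π)⁰`** (`Π` compact tempered): every connected `B₁` receives an arrow
from a connected object `X` whose base-point stabiliser is NORMAL (namely `X = Π/N`, `N` the normal core
of the stabiliser of a point of `B₁`); by `exists_iso_comp_eq_of_comp_eq`, `X` is intrinsically Galois
over every `C` under `B₁` — in our words, a Galois covering dominating `B₁ → C`, which is how condition (b)
of the printed proof (a statement about morphisms that project "to a Galois covering `φ_D : B_D → C_D`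
of `D_i`") gets applied to an arbitrary morphism. [cite: MochizukiFrdII2008, Thm 2.4 (i) p.20] -/
theorem exists_normal_galois_dominating (hG : IsTempered G) (B₁ : ConnectedPart (BTemp G)) :
    ∃ (X : ConnectedPart (BTemp G)) (x₀ : X.obj.obj.V) (g : X ⟶ B₁),
      (stabilizerSubgroup X.obj x₀).Normal ∧ ptMap g x₀ = basePt B₁ := by
  let S : Subgroup G := stabilizerSubgroup B₁.obj (basePt B₁)
  have hS : IsOpen (S : Set G) := isOpen_stabilizerSubgroup B₁.obj (basePt B₁)
  let N : Subgroup G := S.normalCore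
  have hN : IsOpen (N : Set G) := isOpen_normalCore_of_isOpen S hS
  let T : BTemp G := cosetObj G hG N hN
  have hρ : ∀ (g : G) (c : G ⧸ N), (T.obj.ρ g c : G ⧸ N) = g • c := fun _ _ => rfl
  let one : T.obj.V := ((1 : G) : G ⧸ N)
  have htr : ∀ c : T.obj.V, ∃ g : G, T.obj.ρ g one = c := by
    intro c
    obtain ⟨g, rfl⟩ := QuotientGroup.mk_surjective c
    exact ⟨g, by rw [hρ]; change g • ((1 : G) : G ⧸ N) = _
                 rw [MulAction.Quotient.smul_coe, smul_eq_mul, mul_one]⟩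
  let X : ConnectedPart (BTemp G) := ⟨T, isConnectedObj_of_transitive T one htr⟩
  -- the stabiliser of `1·N` is `N`, which is normal
  have hstab : stabilizerSubgroup X.obj one = N := by
    ext g
    rw [mem_stabilizerSubgroup_iff]
    change g • ((1 : G) : G ⧸ N) = ((1 : G) : G ⧸ N) ↔ g ∈ N
    rw [MulAction.Quotient.smul_coe, smul_eq_mul, mul_one, eq_comm, QuotientGroup.eq, inv_one, one_mul]
  haveI : (stabilizerSubgroup X.obj one).Normal := by rw [hstab]; infer_instance
  -- `N ≤ S = Stab(x_{B₁})`, so `1·N ↦ x_{B₁}` extends to a morphism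
  obtain ⟨g, hg⟩ := exists_hom_of_stabilizer_le (T₁ := X.obj) (T₂ := B₁.obj) one htr (basePt B₁)
    (fun g hg' => by
      have h1 : g ∈ N := by rw [← hstab]; exact (mem_stabilizerSubgroup_iff).mpr hg'
      exact (mem_stabilizerSubgroup_iff).mp (Subgroup.normalCore_le S h1))
  exact ⟨X, one, ObjectProperty.homMk g, inferInstance, hg⟩

end Compact

/-! ### The Galois-correspondence base `B^temp(G_F)⁰ → D₀`: `H_dom` and `H_fix` discharged -/

section GaloisBase

variable (F : Type u) [Field F] [PerfectField F]

/-- **`H_dom` for the Galois-correspondence base** (`Gal f :=` "the stabiliser of the base point of the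
SOURCE of `f` is normal in `G_F`"): every `f₁ : B₁ → C` of `B^temp(G_F)⁰` is dominated by a Galois
`B → B₁ → C` (Galois closure). Shape = the binder `hdom` of
`PadicFrd.Datum.isFieldwiseSaturated_iff_divisible_and_descent`. [cite: MochizukiFrdII2008, Thm 2.4 (i) p.20] -/
theorem galoisFields_hdom ⦃B₁ C : ConnectedPart (BTemp (GalFbar F))⦄ (_f₁ : B₁ ⟶ C) :
    ∃ (B : ConnectedPart (BTemp (GalFbar F))) (_g : B ⟶ B₁),
      (stabilizerSubgroup B.obj (basePt B)).Normal := by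
  haveI : IsGalois F (Fbar F) := {}
  obtain ⟨X, x₀, g, hN, -⟩ := exists_normal_galois_dominating (isTempered_galFbar F) B₁
  haveI := hN
  exact ⟨X, g, by rw [stabilizerSubgroup_eq_of_normal X x₀ (basePt X)]; exact hN⟩

variable {F}

omit [PerfectField F] in
/-- Over a Galois `B` (normal base-point stabiliser), **every `h ∈ G_F` stabilising `f(x_B)` is realised by
an automorphism `σ` of `B` OVER `C`** (`σ x_B = h · x_B`), and the field map of `σ` is `a ↦ h · a` on
`K_B = F̄^{Stab(x_B)}`; hence an element of `K_B` fixed by all field maps of automorphisms over `C` is fixed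
by `Stab(f x_B)`. [cite: MochizukiFrdII2008, Thm 2.4 (i) p.20] -/
theorem apply_eq_of_forall_over {B C : ConnectedPart (BTemp (GalFbar F))} (f : B ⟶ C)
    [hN : (stabilizerSubgroup B.obj (basePt B)).Normal] (x : fixFld F B)
    (hx : ∀ σ : B ⟶ B, σ ≫ f = f → fieldMap σ x = x) (h : GalFbar F)
    (hh : C.obj.obj.ρ h (ptMap f (basePt B)) = ptMap f (basePt B)) : h (x : Fbar F) = x := by
  obtain ⟨τ, hτ⟩ := exists_iso_apply_eq B (basePt B) (basePt B) (B.obj.obj.ρ h (basePt B))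
  -- `τ` lies over `C`
  have hover : τ.hom ≫ f = f := by
    apply ObjectProperty.hom_ext
    refine hom_eq_of_apply_eq B.property _ _ (basePt B) ?_
    change ptMap f (ptMap τ.hom (basePt B)) = ptMap f (basePt B)
    rw [hτ, ptMap_ρ, hh]
  have h1 := hx τ.hom hover
  have h2 : ((fieldMap τ.hom x : fixFld F B) : Fbar F) = h x := fieldMap_apply_of_ρ_eq τ.hom hτ.symm x
  rw [h1] at h2
  exact h2.symm

omit [PerfectField F] in
/-- **`H_fix` for the Galois-correspondence base (Galois theory)**: for `f : B → C` of `B^temp(G_F)⁰` with `B`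
Galois, an element `x ∈ K_B = F̄^{Stab(x_B)}` fixed by the field maps of all `σ : B → B` over `C` is the image
of an element of `K_C = F̄^{Stab(x_C)}` under the field map `a ↦ g_f · a` of `f`: indeed `x` is fixed by
`Stab(f x_B) = g_f Stab(x_C) g_f⁻¹` (`apply_eq_of_forall_over`), so `g_f⁻¹ x ∈ K_C`.
[cite: MochizukiFrdII2008, Thm 2.4 (i) p.20] -/
theorem exists_fieldMap_eq_of_forall_over {B C : ConnectedPart (BTemp (GalFbar F))} (f : B ⟶ C)
    [hN : (stabilizerSubgroup B.obj (basePt B)).Normal] (x : fixFld F B)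
    (hx : ∀ σ : B ⟶ B, σ ≫ f = f → fieldMap σ x = x) :
    ∃ x₀ : fixFld F C, fieldMap f x₀ = x := by
  -- `g = g_f` carries `x_C` to `f(x_B)`
  have hg := carrier_spec f
  set g : GalFbar F := carrier f with hgdef
  -- `g⁻¹ x` is fixed by `Stab(x_C)` (conjugate into `Stab(f x_B)` and use `apply_eq_of_forall_over`)
  have hmem : g.symm (x : Fbar F) ∈ fixFld F C := by
    rw [mem_fixFld_iff]
    intro s hs
    have hh : C.obj.obj.ρ (g * s * g⁻¹) (ptMap f (basePt B)) = ptMap f (basePt B) := by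
      rw [← hg, ρ_mul_apply, ρ_mul_apply, ρ_inv_apply, hs]
    have h1 := apply_eq_of_forall_over f x hx (g * s * g⁻¹) hh
    rw [AlgEquiv.mul_apply, AlgEquiv.mul_apply, AlgEquiv.aut_inv] at h1
    simpa using congrArg g.symm h1
  refine ⟨⟨g.symm (x : Fbar F), hmem⟩, Subtype.ext ?_⟩
  rw [fieldMap_apply_of_ρ_eq f hg]
  exact g.apply_symm_apply (x : Fbar F)

variable (F)

/-- **`H_fix` in EXACTLY the binder shape** (`hfix` of `PadicFrd.Datum.descent_of_isFieldwiseSaturated` /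
`isFieldwiseSaturated_iff_divisible_and_descent`) for the base functor `galoisFields F : B^temp(G_F)⁰ ⥤ D₀`
and `Gal f :=` "the base-point stabiliser of the source is normal". [cite: MochizukiFrdII2008, Thm 2.4 (i) p.20] -/
theorem galoisFields_hfix ⦃B C : ConnectedPart (BTemp (GalFbar F))⦄ (f : B ⟶ C)
    (hGal : (stabilizerSubgroup B.obj (basePt B)).Normal) (x : ((galoisFields F).obj B).carrier)
    (hx : ∀ σ : B ⟶ B, σ ≫ f = f → ((galoisFields F).map σ).alg x = x) :
    ∃ x₀ : ((galoisFields F).obj C).carrier, ((galoisFields F).map f).alg x₀ = x :=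
  haveI := hGal
  exists_fieldMap_eq_of_forall_over f x hx

end GaloisBase

/-! ### The valued form `B^temp(G_{ℚ_p})⁰ → PadicFld p` (the base of FrdII Theorem 1.2 / Example 1.1 (ii)) -/

section Padic

variable (p : ℕ) [Fact p.Prime]

/-- **`H_dom` for `galoisPadicFields p`** (binder shape `hdom`, `Gal f :=` normal base-point stabiliser of
the source). [cite: MochizukiFrdII2008, Thm 2.4 (i) p.20] -/
theorem galoisPadicFields_hdom ⦃B₁ C : ConnectedPart (BTemp (GalFbar ℚ_[p]))⦄ (f₁ : B₁ ⟶ C) :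
    ∃ (B : ConnectedPart (BTemp (GalFbar ℚ_[p]))) (_g : B ⟶ B₁),
      (stabilizerSubgroup B.obj (basePt B)).Normal :=
  galoisFields_hdom ℚ_[p] f₁

/-- **`H_fix` for `galoisPadicFields p`** in EXACTLY the binder shape `hfix` (with `d.fld B = (base.obj B).K`,
`(base.map σ).alg` the valued field map): for `f : B → C` with `B` Galois, an element of
`K_B = ℚ̄_p^{Stab(x_B)}` fixed by all `(base.map σ).alg`, `σ` over `C`, is `(base.map f).alg x₀` for some
`x₀ ∈ K_C`. [cite: MochizukiFrdII2008, Thm 2.4 (i) p.20] -/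
theorem galoisPadicFields_hfix ⦃B C : ConnectedPart (BTemp (GalFbar ℚ_[p]))⦄ (f : B ⟶ C)
    (hGal : (stabilizerSubgroup B.obj (basePt B)).Normal) (x : ((galoisPadicFields p).obj B).K)
    (hx : ∀ σ : B ⟶ B, σ ≫ f = f → ((galoisPadicFields p).map σ).alg x = x) :
    ∃ x₀ : ((galoisPadicFields p).obj C).K, ((galoisPadicFields p).map f).alg x₀ = x :=
  haveI := hGal
  exists_fieldMap_eq_of_forall_over f x hx

end Padic

end QuasiTemperoid

end Literature.AlgebraicGeometry.Frobenioids

end
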